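import Summits.CriticalPhenomena.PercolationContinuityZ3.Theorems.PercNearOneGluingNoHeavyLowerTailCubicThreePointApexSplit
import Mathlib.Tactic.Ring
import Mathlib.Tactic.Linarith
import Mathlib.Tactic.Positivity
import HarnessLib

/-!
# `NoHeavyLowerTail` (stmt-CriticalPhenomena-4575) — the ONE-EDGE STEP for the apex-refined row `Γ`: chord identity, transition calculus,
# and the reduction of `Γ ≥ 0` (all weighted graphs) to a single four-point step lemma on `b`-incident edges

Support file (prover prim-ineq-gen-2 gen 3, new-inequality factory; `--supports stmt-CriticalPhenomena-4575`).  Pure algebra over a commutative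
ring / `ℝ`; no measure theory, no named facts, no sorries.  Continues `…CubicThreePointApexSplit` (`CubicThreePointApex.Gam`:
`Γ = AG − u₃(n + n′)`, apex `a`, `n = P(abc ∧ b≁c in ω∖a)`, `n′ = P(a|b|c ∧ V(C_a) separates b,c)`; ttrl2 census `hms`: `Γ ≥ 0` with 0 violations on
ALL weighted graphs with `≤ 8` vertices, 39.2·10⁶ exact evaluations in 21 weight families).

## The refined cell vector and the one-edge segment
Write the law in the seven APEX-REFINED cells `x = (W, N′, U₁, U₂, U₃, N, M)` with `q = W + N′` (`N′` = the separating part of `a|b|c`), `t = N + M`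
(`N` = the `a`-pivotal part of `abc`), so that `Γ(x) = (W+N′)(N+M) − U₁U₂ − U₃(U₁+U₂+N+N′)` (`GamR`, `GamR_eq_Gam`).  Conditioning on the state of ONE
edge `e` (weight `p`) writes the refined law of `G` as `x_p = (1−p)x⁰ + p x¹` (sections; `N′` of both sections taken w.r.t. separation in the support of
`G`), and for the quadratic form `Γ` one has GLADKOV'S CHORD IDENTITY
  `Γ(x_p) = (1−p)·Γ(x⁰) + p·Γ(x¹) + p(1−p)·Φ`,   `Φ := Γ(x⁰,x¹) + Γ(x¹,x⁰) − Γ(x⁰,x⁰) − Γ(x¹,x¹) = −Γ(d,d)`, `d = x¹ − x⁰`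
(`GamR_segment`), exactly as in Gladkov's proof of `AG ≥ 0` (tree `Literature…StrongHarrisKleitman`, `step_arith`).  Hence (`GamR_segment_nonneg`)
`Φ ≥ 0 ∧ Γ(x⁰) ≥ 0 ∧ Γ(x¹) ≥ 0 ⟹ Γ(x_p) ≥ 0`.
## Transition calculus
Opening one edge moves mass between the refined cells only along the twelve arrows
`W→N′, W→U₁, W→U₂, W→U₃, N′→U₁, N′→U₂, U₁→N, U₁→M, U₂→N, U₂→M, U₃→M, N→M`
(a `b–c` connection created while `a` stays separate cannot be undone; a separating `C_a` stays separating; from `bc|a` the apex can only be glued, never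
made pivotal; …).  With transition masses `α_{N′}, α₁, α₂, α₃` (out of `W`), `β₁, β₂` (out of `N′`), `γ₁ᴺ, γ₁ᴹ, γ₂ᴺ, γ₂ᴹ, γ₃` (out of `U₁,U₂,U₃`),
`δ` (`N→M`) and arbitrary staying masses, the chord defect is the EXPLICIT quadratic (`Phi_transition`, by `ring`)
  `Φ = P₀ + (α₃ − γ₃)(α_{N′} − δ)`,
  `P₀ = (α₁+β₁)(γ₁ᴺ+γ₁ᴹ) + (α₂+β₂)(γ₂ᴺ+γ₂ᴹ) + α₃γ₃ + (β₁+β₂)γ₃ + α₃(γ₁ᴺ+γ₂ᴺ) + (α₁+β₁)(α₂+β₂) + (γ₁ᴺ+γ₁ᴹ)(γ₂ᴺ+γ₂ᴹ) + α₃(α₁+α₂) + γ₃(γ₁ᴹ+γ₂ᴹ)`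
(independent of the staying masses; `P₀ ≥ 0` for nonnegative masses).  APEX edges have `α₃ = δ = 0`, `Φ = P₀ − γ₃α_{N′}`, which CAN be negative (census:
1 692 of 6.0·10⁶ apex edge-steps at `n = 7`; Steiner–Steiner edges realise the same mechanism, 176 failures) — the one-coordinate induction must avoid them.
Edges at the terminal `b`, `e = (b,v)`, have `α_{N′} = α₂ = β₂ = γ₁ᴺ = 0` and (`Phi_bEdge`)
  `Φ_b = (α₁+β₁)γ₁ᴹ + α₃γ₃ + β₁γ₃ + α₃γ₂ᴺ + γ₁ᴹ(γ₂ᴺ+γ₂ᴹ) + α₃α₁ + γ₃(γ₁ᴹ+γ₂ᴹ) + γ₃δ − α₃δ`.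
For `e = (b,c)` only `α₃ = q⁰, γ₁ᴹ = u₁⁰, γ₂ᴹ = u₂⁰, δ = n⁰` survive and `Φ = u₁⁰u₂⁰ − q⁰n⁰ ≥ 0` IS van den Berg–Häggström–Kahn's conditional negative correlation
(RSA 2006, Thm 1.4: given `b ≁ c`, increasing functions of `C_b` and of `C_c` are negatively correlated; applied in `G − a − e` to the apex-attachment
probabilities) — ttrl2: identity and sign confirmed on all 1.09·10⁶ `bc`-edge steps.  For `b–Steiner` edges `Φ_b ≥ 0` is LEMMA B (open; 0 violations in
8.54·10⁶ exact terminal-edge steps `n ≤ 7`, all 21 weight families; every single-correction weakening `α₃δ ≤ γ₁ᴹγ₂ᴹ + (one term)` is false somewhere).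
## The reduction recorded here (`GamR_induction_shape`)
If `Φ_b ≥ 0` on every `b`-incident non-apex edge of every weighted graph (LEMMA B + BHK), then `Γ ≥ 0` on every weighted graph: induct on the number
of edges; a graph whose only edges at `b` go to `a` (or none) has `u₃·(n+n′) = 0 = AG`-defect… precisely `Γ = 0`; otherwise take a `b`-edge `e ≠ (b,a)`,
`Γ(G) = Γ(x_{p_e}) ≥ (1−p)Γ(x⁰) + pΓ(x¹)`, and `Γ(x⁰) ≥ Γ(G∖e)` (same cells and `n`; `n′` can only be larger in `G∖e`), `Γ(x¹) = Γ(G/e)` (a non-apex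
contraction preserves all seven refined cells).  This file supplies the algebra of that argument; the measure-theoretic wrapper (sections = minors, the
twelve-arrow support of the transition kernel) is the remaining formalization task, in the framework of `…CubicThreePointSections/Transitions`.
Memo: run/shared/lean/prim/prim-ineq-gen-2/HMAX-SPLIT.md §6–§7; census run/shared/lean/ttrl/hms/README.md.
[cite: Gladkov2024StrongFKG, §2 (proof of Thm. 2.1: the quadratic-in-`p` step)]; [cite: GladkovZimin2024HK, §4 (one-coordinate decomposition)]
-/

namespace Summit.CriticalPhenomena.PercolationContinuityZ3.Theorems

namespace CubicThreePointApex

open CubicThreePointTerminal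

variable {R : Type*} [CommRing R]

/-! ### `Γ` on the refined seven-cell vector, its polarisation, and the chord identity -/

/-- `Γ` in apex-refined cells `(W, N′, U₁, U₂, U₃, N, M)`: `(W+N′)(N+M) − U₁U₂ − U₃(U₁+U₂+N+N′)`. [folklore] -/
def GamR (W N' U₁ U₂ U₃ N M : R) : R := (W + N') * (N + M) - U₁ * U₂ - U₃ * (U₁ + U₂ + N + N')

/-- `GamR` is `Gam` with `q = W + N′`, `t = N + M`, `n = N`, `n′ = N′`. [folklore] -/
theorem GamR_eq_Gam (W N' U₁ U₂ U₃ N M : R) :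
    GamR W N' U₁ U₂ U₃ N M = Gam (W + N') U₁ U₂ U₃ (N + M) N N' := by
  simp only [GamR, Gam, AG]; ring

/-- The polarised (non-symmetric) bilinear form of `Γ`: `Γ(x,y) = (W_x+N′_x)(N_y+M_y) − U₁ˣU₂ʸ − U₃ˣ(U₁ʸ+U₂ʸ+Nʸ+N′ʸ)` (all fourteen cells are
arguments so that `Γ(x,x) = Γ(x)` literally; five of them do not occur). [folklore] -/
def GamB (W N' U₁ _U₂ U₃ _N _M _W' N'' V₁ V₂ _V₃ N₂ M₂ : R) : R :=
  (W + N') * (N₂ + M₂) - U₁ * V₂ - U₃ * (V₁ + V₂ + N₂ + N'')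

/-- `Γ(x) = Γ(x,x)`. [folklore] -/
theorem GamB_diag (W N' U₁ U₂ U₃ N M : R) :
    GamB W N' U₁ U₂ U₃ N M W N' U₁ U₂ U₃ N M = GamR W N' U₁ U₂ U₃ N M := by
  simp only [GamB, GamR]

/-- **Gladkov's chord identity for `Γ`.**  Along the one-edge segment `x_p = (1−p)x⁰ + p x¹`:
`Γ(x_p) = (1−p)Γ(x⁰) + pΓ(x¹) + p(1−p)Φ` with `Φ = Γ(x⁰,x¹) + Γ(x¹,x⁰) − Γ(x⁰,x⁰) − Γ(x¹,x¹)`. [cite: Gladkov2024StrongFKG, §2 (the step)] -/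
theorem GamR_segment (p W₀ N₀' A₀ B₀ C₀ N₀ M₀ W₁ N₁' A₁ B₁ C₁ N₁ M₁ : R) :
    GamR ((1 - p) * W₀ + p * W₁) ((1 - p) * N₀' + p * N₁') ((1 - p) * A₀ + p * A₁) ((1 - p) * B₀ + p * B₁)
        ((1 - p) * C₀ + p * C₁) ((1 - p) * N₀ + p * N₁) ((1 - p) * M₀ + p * M₁) =
      (1 - p) * GamR W₀ N₀' A₀ B₀ C₀ N₀ M₀ + p * GamR W₁ N₁' A₁ B₁ C₁ N₁ M₁ +
        p * (1 - p) * (GamB W₀ N₀' A₀ B₀ C₀ N₀ M₀ W₁ N₁' A₁ B₁ C₁ N₁ M₁ + GamB W₁ N₁' A₁ B₁ C₁ N₁ M₁ W₀ N₀' A₀ B₀ C₀ N₀ M₀ -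
          GamR W₀ N₀' A₀ B₀ C₀ N₀ M₀ - GamR W₁ N₁' A₁ B₁ C₁ N₁ M₁) := by
  simp only [GamR, GamB]; ring

/-- **The one-coordinate step.**  If the chord defect `Φ` is nonnegative and `Γ` is nonnegative at both sections, then `Γ ≥ 0` on the whole
segment `p ∈ [0,1]`. [cite: Gladkov2024StrongFKG, §2 (the step)] -/
theorem GamR_segment_nonneg {p W₀ N₀' A₀ B₀ C₀ N₀ M₀ W₁ N₁' A₁ B₁ C₁ N₁ M₁ : ℝ} (hp₀ : 0 ≤ p) (hp₁ : p ≤ 1)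
    (h₀ : 0 ≤ GamR W₀ N₀' A₀ B₀ C₀ N₀ M₀) (h₁ : 0 ≤ GamR W₁ N₁' A₁ B₁ C₁ N₁ M₁)
    (hΦ : 0 ≤ GamB W₀ N₀' A₀ B₀ C₀ N₀ M₀ W₁ N₁' A₁ B₁ C₁ N₁ M₁ + GamB W₁ N₁' A₁ B₁ C₁ N₁ M₁ W₀ N₀' A₀ B₀ C₀ N₀ M₀ -
          GamR W₀ N₀' A₀ B₀ C₀ N₀ M₀ - GamR W₁ N₁' A₁ B₁ C₁ N₁ M₁) :
    0 ≤ GamR ((1 - p) * W₀ + p * W₁) ((1 - p) * N₀' + p * N₁') ((1 - p) * A₀ + p * A₁) ((1 - p) * B₀ + p * B₁)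
        ((1 - p) * C₀ + p * C₁) ((1 - p) * N₀ + p * N₁) ((1 - p) * M₀ + p * M₁) := by
  rw [GamR_segment]
  have hq : 0 ≤ 1 - p := by linarith
  have := mul_nonneg (mul_nonneg hp₀ hq) hΦ
  nlinarith [mul_nonneg hq h₀, mul_nonneg hp₀ h₁]

/-! ### Transition calculus: the chord defect in the twelve transition masses -/

/-- **The chord defect in transition masses.**  If the two sections are linked by staying masses `s_X` and the twelve admissible transition
masses (`x⁰_X = s_X + outflow(X)`, `x¹_Y = s_Y + inflow(Y)`), then `Φ = P₀ + (α₃ − γ₃)(α_{N′} − δ)` with the explicit nonnegative-coefficient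
quadratic `P₀` of the docstring (the staying masses cancel). [folklore] -/
theorem Phi_transition (sW sN' s₁ s₂ s₃ sN sM aN' a₁ a₂ a₃ b₁ b₂ g₁N g₁M g₂N g₂M g₃ d : R) :
    let W₀ := sW + aN' + a₁ + a₂ + a₃
    let N₀' := sN' + b₁ + b₂
    let A₀ := s₁ + g₁N + g₁M
    let B₀ := s₂ + g₂N + g₂M
    let C₀ := s₃ + g₃
    let N₀ := sN + d
    let M₀ := sM
    let W₁ := sW
    let N₁' := sN' + aN'
    let A₁ := s₁ + a₁ + b₁
    let B₁ := s₂ + a₂ + b₂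
    let C₁ := s₃ + a₃
    let N₁ := sN + g₁N + g₂N
    let M₁ := sM + g₁M + g₂M + g₃ + d
    GamB W₀ N₀' A₀ B₀ C₀ N₀ M₀ W₁ N₁' A₁ B₁ C₁ N₁ M₁ + GamB W₁ N₁' A₁ B₁ C₁ N₁ M₁ W₀ N₀' A₀ B₀ C₀ N₀ M₀ -
        GamR W₀ N₀' A₀ B₀ C₀ N₀ M₀ - GamR W₁ N₁' A₁ B₁ C₁ N₁ M₁ =
      ((a₁ + b₁) * (g₁N + g₁M) + (a₂ + b₂) * (g₂N + g₂M) + a₃ * g₃ + (b₁ + b₂) * g₃ + a₃ * (g₁N + g₂N) +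
          (a₁ + b₁) * (a₂ + b₂) + (g₁N + g₁M) * (g₂N + g₂M) + a₃ * (a₁ + a₂) + g₃ * (g₁M + g₂M)) +
        (a₃ - g₃) * (aN' - d) := by
  simp only [GamB, GamR]; ring

/-- **Edges at the terminal `b`** (`e = (b,v)`): no `W→N′`, `W→U₂`, `N′→U₂`, `U₁→N` transitions, and the defect is
`Φ_b = (α₁+β₁)γ₁ᴹ + α₃γ₃ + β₁γ₃ + α₃γ₂ᴺ + γ₁ᴹ(γ₂ᴺ+γ₂ᴹ) + α₃α₁ + γ₃(γ₁ᴹ+γ₂ᴹ) + γ₃δ − α₃δ`; LEMMA B asserts `Φ_b ≥ 0` on every weighted graph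
(0 violations in 8.54·10⁶ exact terminal-edge steps, `n ≤ 7`). [folklore] -/
theorem Phi_bEdge (sW sN' s₁ s₂ s₃ sN sM a₁ a₃ b₁ g₁M g₂N g₂M g₃ d : R) :
    let W₀ := sW + a₁ + a₃
    let N₀' := sN' + b₁
    let A₀ := s₁ + g₁M
    let B₀ := s₂ + g₂N + g₂M
    let C₀ := s₃ + g₃
    let N₀ := sN + d
    let M₀ := sM
    let W₁ := sW
    let N₁' := sN'
    let A₁ := s₁ + a₁ + b₁
    let B₁ := s₂
    let C₁ := s₃ + a₃
    let N₁ := sN + g₂N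
    let M₁ := sM + g₁M + g₂M + g₃ + d
    GamB W₀ N₀' A₀ B₀ C₀ N₀ M₀ W₁ N₁' A₁ B₁ C₁ N₁ M₁ + GamB W₁ N₁' A₁ B₁ C₁ N₁ M₁ W₀ N₀' A₀ B₀ C₀ N₀ M₀ -
        GamR W₀ N₀' A₀ B₀ C₀ N₀ M₀ - GamR W₁ N₁' A₁ B₁ C₁ N₁ M₁ =
      (a₁ + b₁) * g₁M + a₃ * g₃ + b₁ * g₃ + a₃ * g₂N + g₁M * (g₂N + g₂M) + a₃ * a₁ + g₃ * (g₁M + g₂M) + g₃ * d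
        - a₃ * d := by
  simp only [GamB, GamR]; ring

/-- **The terminal–terminal edge `e = (b,c)`**: only `α₃ = q⁰`, `γ₁ᴹ = u₁⁰`, `γ₂ᴹ = u₂⁰`, `δ = n⁰` move, and `Φ = u₁⁰u₂⁰ − q⁰n⁰` — nonnegative by
van den Berg–Häggström–Kahn's conditional negative correlation (RSA 2006, Thm 1.4) applied in `G − a − e` to the apex-attachment probabilities
of `C_b` and `C_c` given `b ≁ c`. [folklore] -/
theorem Phi_bcEdge (sW sN' s₁ s₂ s₃ sN sM a₃ g₁M g₂M d : R) :
    let W₀ := sW + a₃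
    let N₀' := sN'
    let A₀ := s₁ + g₁M
    let B₀ := s₂ + g₂M
    let C₀ := s₃
    let N₀ := sN + d
    let M₀ := sM
    let W₁ := sW
    let N₁' := sN'
    let A₁ := s₁
    let B₁ := s₂
    let C₁ := s₃ + a₃
    let N₁ := sN
    let M₁ := sM + g₁M + g₂M + d
    GamB W₀ N₀' A₀ B₀ C₀ N₀ M₀ W₁ N₁' A₁ B₁ C₁ N₁ M₁ + GamB W₁ N₁' A₁ B₁ C₁ N₁ M₁ W₀ N₀' A₀ B₀ C₀ N₀ M₀ -
        GamR W₀ N₀' A₀ B₀ C₀ N₀ M₀ - GamR W₁ N₁' A₁ B₁ C₁ N₁ M₁ = g₁M * g₂M - a₃ * d := by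
  simp only [GamB, GamR]; ring

/-- `Φ_b ≥ 0` in the easy regime `γ₃ ≥ α₃` (the apex is glued to the `bc`-cluster through `v` at least as often as `b` reaches `c` through `v`
from `a|b|c`): then every term is nonnegative. [folklore] -/
theorem Phi_bEdge_nonneg_of_le {a₁ a₃ b₁ g₁M g₂N g₂M g₃ d : ℝ} (ha₁ : 0 ≤ a₁) (ha₃ : 0 ≤ a₃) (hb₁ : 0 ≤ b₁) (hg₁ : 0 ≤ g₁M)
    (hg₂N : 0 ≤ g₂N) (hg₂M : 0 ≤ g₂M) (hg₃ : 0 ≤ g₃) (hd : 0 ≤ d) (h : a₃ ≤ g₃) :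
    0 ≤ (a₁ + b₁) * g₁M + a₃ * g₃ + b₁ * g₃ + a₃ * g₂N + g₁M * (g₂N + g₂M) + a₃ * a₁ + g₃ * (g₁M + g₂M) + g₃ * d - a₃ * d := by
  have h1 : 0 ≤ (g₃ - a₃) * d := mul_nonneg (by linarith) hd
  nlinarith [mul_nonneg (add_nonneg ha₁ hb₁) hg₁, mul_nonneg ha₃ hg₃, mul_nonneg hb₁ hg₃, mul_nonneg ha₃ hg₂N,
    mul_nonneg hg₁ (add_nonneg hg₂N hg₂M), mul_nonneg ha₃ ha₁, mul_nonneg hg₃ (add_nonneg hg₁ hg₂M)]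

/-- `Φ_b ≥ 0` whenever the `T1`-type domination `α₃δ ≤ γ₁ᴹγ₂ᴹ + γ₁ᴹγ₂ᴺ + α₃(α₁+γ₂ᴺ) + γ₃δ` holds (all other terms are nonnegative); the census shows
that NO proper subset of these four correction terms suffices on all graphs, while the full `Φ_b` never fails. [folklore] -/
theorem Phi_bEdge_nonneg_of_dom {a₁ a₃ b₁ g₁M g₂N g₂M g₃ d : ℝ} (ha₁ : 0 ≤ a₁) (ha₃ : 0 ≤ a₃) (hb₁ : 0 ≤ b₁) (hg₁ : 0 ≤ g₁M)
    (hg₂M : 0 ≤ g₂M) (hg₃ : 0 ≤ g₃)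
    (h : a₃ * d ≤ g₁M * g₂M + g₁M * g₂N + a₃ * (a₁ + g₂N) + g₃ * d) :
    0 ≤ (a₁ + b₁) * g₁M + a₃ * g₃ + b₁ * g₃ + a₃ * g₂N + g₁M * (g₂N + g₂M) + a₃ * a₁ + g₃ * (g₁M + g₂M) + g₃ * d - a₃ * d := by
  nlinarith [mul_nonneg (add_nonneg ha₁ hb₁) hg₁, mul_nonneg ha₃ hg₃, mul_nonneg hb₁ hg₃, mul_nonneg hg₃ (add_nonneg hg₁ hg₂M)]

end CubicThreePointApex

end Summit.CriticalPhenomena.PercolationContinuityZ3.Theorems
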